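/-
Copyright (c) 2026. All rights reserved.
Released under Apache 2.0 license as described in the file LICENSE.
Authors: abc-iut cell, seat abc-iut-L4-t9 (gen 4; block W2-B2, model of [AbsTopIII] Cor 3.7 — honest
scope of the lift datum `θ^bi`).
-/
import Literature.AnabelianGeometry.AbsoluteAnabelian.AbsTopIII.BiAnabelianModelNonRigidity
import Literature.AnabelianGeometry.AbsoluteAnabelian.AbsTopIII.BiAnabelianModelSlim
import HarnessLib

/-!
# [AbsTopIII] Cor 3.7 (ii): the bi-anabelian lift datum `θ^bi` does NOT exist for the bare model of
# MLF-Galois `TF`-pairs on `ℚ̄_p`, nor for its slim sub-model — it is exactly the Cor 1.10 input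

S. Mochizuki, *Topics in absolute anabelian geometry III* [MochizukiAbsTopIII2015] (kurims manuscript
`paper:url-5493eb38cbb7`), Cor 3.7 (ii) p. 87: "`θ^bi : pr^bi_1 ⥲ pr^bi_2` the isomorphism between the two
projection functors `pr^bi_1, pr^bi_2 : 𝒳 ×_𝔈 𝒳 → 𝒳` that arises from the functoriality — i.e., the
bi-anabelian [or 'Grothendieck Conjecture'-type] portion [cf. Remark 1.9.8] — of the 'group-theoretic'
algorithms of Corollary 1.10", for `𝒳 = 𝒞^{MLF-sB}_{T𝔽}` (pairs OF STRICTLY BELYI TYPE) and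
`𝔈 = 𝒯𝔾_{sB}`.

abc-iut-L4-t9 typed `θ^bi` as the hypothesis structure `FiberSquare.BiAnabelianLift` and proved Cor 3.7
(ii)/(iv)/(v) "for every `θ`" over every abstract setting, over the MODEL `TFModel.modelSetting p` (gen 3,
ALL model pairs `(Π_k ↷ ℚ̄_p)`, `𝔈 =` all topological groups and their isomorphisms) and over its slim
sub-model `TFModel.modelSettingSlim p` (gen 4).  THIS FILE records, as kernel facts, that at these two
models the quantification over `θ` is VACUOUS — so there (ii), the second incompatibility of (iv), and (v)
are REDUCED to `θ^bi`, not discharged — and hence that `θ^bi` is precisely where Cor 1.10 (the relative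
bi-anabelian input for strictly-Belyi-type curves, campaign-L base) enters Cor 3.7:

* `TFModel.swapObj p` — the model object `(Π := G × G ↠ G ↷ ℚ̄_p)` over `ℚ_p` (`ε = pr₁`,
  `G = Gal(ℚ̄_p/ℚ_p)`), legitimate Def 3.1 (i) data ("let `Π_k` be a topological group, equipped with a
  continuous surjection `ε_k : Π_k ↠ G_k`") that is NOT of strictly Belyi type; its `Π` is slim
  (`isSlimGroup_prod`), so it even lies in `TFModel.Slim p`;
* `TFModel.gal_map_ne_swap` — no endomorphism of `swapObj` in `𝒳` lies over the factor swap
  `G × G ⥲ G × G` (it would force `σ g₁ σ⁻¹ = g₂` on `ℚ̄_p` for all `(g₁, g₂)`, but `G ≠ 1`: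
  `σ(√p) = -√p` for some `σ`, gen 3's `exists_algEquiv_neg_sqrtPrime`);
* `TFModel.isEmpty_biAnabelianLift_modelSetting`, `TFModel.isEmpty_biAnabelianLift_modelSettingSlim` —
  **no bi-anabelian lift datum exists** for the bare model and for the slim sub-model.

The honest home of `θ^bi` is a `P`-sub-model for `P` = "of strictly Belyi type" (the tree has no étale
`π₁`; cf. the `P`-parametrised devices `BiAnabelianSetting.restrict P` / `TFModel.isIdRigid_fullSubcategory_of_slim P`
and abc-iut-L4-t5's `P`-parametrised Cor 3.6 model).  HONEST FRAMING: statements about OUR models; they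
contradict nothing in print (print never claims `θ^bi` for arbitrary `Π_k`) and bear on nothing in
[IUTchIII] Cor. 3.12.
-/

set_option autoImplicit false

noncomputable section

namespace Literature.AnabelianGeometry.AbsoluteAnabelian.AbsTopIII

open CategoryTheory CategoryTheory.Limits
open Literature.AlgebraicGeometry.Frobenioids (IsSlimGroup)

/-! ## Products of slim groups are slim -/

/-- The product of two slim topological groups is slim: an open subgroup `U ⊆ G × H` contains
`U₁ × U₂` with `U₁ = {g | (g,1) ∈ U}`, `U₂ = {h | (1,h) ∈ U}` open subgroups, and a centraliser of `U`
centralises `U₁ × 1` and `1 × U₂` componentwise. [cite: MochizukiAbsTopIII2015, Section 0 p.27] -/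
theorem isSlimGroup_prod {G H : Type*} [Group G] [TopologicalSpace G] [Group H] [TopologicalSpace H]
    (hG : IsSlimGroup G) (hH : IsSlimGroup H) : IsSlimGroup (G × H) := by
  refine ⟨fun U hU => ?_⟩
  rw [eq_bot_iff]
  rintro ⟨a, b⟩ hz
  rw [Subgroup.mem_centralizer_iff] at hz
  -- the open subgroups `U₁ ⊆ G`, `U₂ ⊆ H`
  let U₁ : Subgroup G := U.comap (MonoidHom.inl G H)
  let U₂ : Subgroup H := U.comap (MonoidHom.inr G H)
  have hU₁ : IsOpen (U₁ : Set G) := hU.preimage (Continuous.prodMk_left 1)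
  have hU₂ : IsOpen (U₂ : Set H) := hU.preimage (Continuous.prodMk_right 1)
  have ha : a ∈ Subgroup.centralizer (U₁ : Set G) := by
    rw [Subgroup.mem_centralizer_iff]
    intro g hg
    have := hz (g, 1) hg
    simpa using congrArg Prod.fst this
  have hb : b ∈ Subgroup.centralizer (U₂ : Set H) := by
    rw [Subgroup.mem_centralizer_iff]
    intro h hh
    have := hz (1, h) hh
    simpa using congrArg Prod.snd this
  rw [hG.centralizer_eq_bot U₁ hU₁, Subgroup.mem_bot] at ha
  rw [hH.centralizer_eq_bot U₂ hU₂, Subgroup.mem_bot] at hb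
  rw [Subgroup.mem_bot, ha, hb]
  rfl

namespace TFModel

variable (p : ℕ) [hp : Fact p.Prime]

/-! ## The witness object `(G × G ↠ G ↷ ℚ̄_p)` and the factor swap -/

/-- `G := Gal(ℚ̄_p/ℚ_p)` viewed over the bottom intermediate field `⊥ = ℚ_p` (the Galois group of the
model objects over `ℚ_p`). [cite: MochizukiAbsTopIII2015, Definition 3.1 (i) p.66] -/
abbrev GalBot : Type := PadicAlgCl p ≃ₐ[(⊥ : IntermediateField ℚ_[p] (PadicAlgCl p))] PadicAlgCl p

/-- **The witness object** `swapObj = (Π := G × G ↠ G ↷ ℚ̄_p)` over `ℚ_p`, `ε =` first projection: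
Def 3.1 (i) model data with a `Π_k` that is not of strictly Belyi type.
[cite: MochizukiAbsTopIII2015, Definition 3.1 (i) p.66] -/
def swapObj : TFModel p where
  k := ⊥
  D := { Pi := GalBot p × GalBot p
         aug := MonoidHom.fst _ _
         continuous_aug := continuous_fst
         aug_surjective := Prod.fst_surjective }

/-- The action of `(g₁, g₂) ∈ G × G` on `ℚ̄_p` is through `g₁`.
[cite: MochizukiAbsTopIII2015, Definition 3.1 (i) p.67] -/
theorem swapObj_augQ_apply (g : (swapObj p).pair.Pi) (x : PadicAlgCl p) :
    (swapObj p).augQ g x = (show GalBot p × GalBot p from g).1 x := rfl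

/-- `Π = G × G` is slim (`G = G_{ℚ_p}` is slim: `isSlimGroup_galk`; products of slim groups are slim),
so `swapObj` lies in the slim sub-model `TFModel.Slim p`. [cite: MochizukiAbsTopIII2015, Proposition 3.2 (iv) p.72] -/
theorem swapObj_isSlim : IsSlimGroup (swapObj p).pair.Pi :=
  isSlimGroup_prod (isSlimGroup_galk (swapObj p)) (isSlimGroup_galk (swapObj p))

/-- The factor swap `G × G ⥲ G × G` as an isomorphism of topological groups.
[cite: MochizukiAbsTopIII2015, Cor 3.7 (ii) p.87] -/
def swapEquiv : (GalBot p × GalBot p) ≃ₜ* (GalBot p × GalBot p) :=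
  ContinuousMulEquiv.mk' (Homeomorph.prodComm (GalBot p) (GalBot p)) fun _ _ => rfl

/-- The factor swap as an isomorphism `gal(swapObj) ≅ gal(swapObj)` in `𝔈 = TopGroupObj` — an object
`(swapObj, swapObj, swap)` of the fibre square `𝒳 ×_𝔈 𝒳`.
[cite: MochizukiAbsTopIII2015, Cor 3.7 (ii) p.87] -/
def swapGalIso : (TFModel.gal p).obj (swapObj p) ≅ (TFModel.gal p).obj (swapObj p) :=
  TopGroupObj.isoOfHom ⟨swapEquiv p⟩

/-- **No endomorphism of `swapObj` in `𝒳` lies over the factor swap**: compatibility with the actions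
would give `σ ∘ g₁ = g₂ ∘ σ` on `ℚ̄_p` for all `(g₁, g₂) ∈ G × G`, i.e. (with `g₁ = 1`) `g₂ = 1` for every
`g₂ ∈ G` — but `σ₀(√p) = -√p ≠ √p` for some `σ₀ ∈ G` (gen 3's `exists_algEquiv_neg_sqrtPrime`).
[cite: MochizukiAbsTopIII2015, Cor 3.7 (ii) p.87] -/
theorem gal_map_ne_swap (f : swapObj p ⟶ swapObj p) : (TFModel.gal p).map f ≠ (swapGalIso p).hom := by
  intro hf
  obtain ⟨σ₀, hσ₀⟩ := exists_algEquiv_neg_sqrtPrime p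
  -- `φ_Π (1, g₂) = (g₂, 1)` for `g₂ := liftBot σ₀`
  have hPi : (f : Hom _ _).hom.homPi ((1 : GalBot p), liftBot p σ₀) = (liftBot p σ₀, (1 : GalBot p)) :=
    congrArg (fun φ : TopGroupObj.Hom _ _ => φ.iso ((1 : GalBot p), liftBot p σ₀)) hf
  -- compatibility with the actions at `g = (1, g₂)` and `y = σ_f⁻¹(√p)`:
  -- `ε(φ_Π g)(φ_M y) = φ_M (ε(g) y)`, i.e. `g₂ (φ_M y) = φ_M y`
  have h1 : (f : Hom _ _).hom.homM ((f : Hom _ _).galois.symm (sqrtPrime p)) = sqrtPrime p := by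
    rw [← Hom.galois_apply, AlgEquiv.apply_symm_apply]
  have e2 := (f : Hom _ _).augQ_homPi_apply ((1 : GalBot p), liftBot p σ₀)
    ((f : Hom _ _).galois.symm (sqrtPrime p))
  rw [hPi, h1] at e2
  change liftBot p σ₀ (sqrtPrime p) =
    (f : Hom _ _).hom.homM ((1 : GalBot p) ((f : Hom _ _).galois.symm (sqrtPrime p))) at e2
  rw [AlgEquiv.one_apply, h1, liftBot_apply, hσ₀] at e2
  exact neg_sqrtPrime_ne p e2

/-! ## No bi-anabelian lift datum exists for the bare model or its slim sub-model -/

/-- **`θ^bi` does not exist for the bare model `TFModel.modelSetting p`**: its component at the object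
`(swapObj, swapObj, swap)` of `𝒳 ×_𝔈 𝒳` would be an endomorphism of `swapObj` over the factor swap.
Hence gen 3's `model_cor_3_7_ii θ` / `model_cor_3_7_iv θ` quantify over an EMPTY type: at this model
Cor 3.7 (ii)/(iv)-second/(v) are reduced to `θ^bi` (= Cor 1.10), not discharged.
[cite: MochizukiAbsTopIII2015, Cor 3.7 (ii) p.87] -/
theorem isEmpty_biAnabelianLift_modelSetting :
    IsEmpty (FiberSquare.BiAnabelianLift (TFModel.modelSetting p).gal) := by
  refine ⟨fun θ => ?_⟩
  let o : CategoricalPullback (TFModel.gal p) (TFModel.gal p) := ⟨swapObj p, swapObj p, swapGalIso p⟩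
  exact gal_map_ne_swap p (θ.θbi.hom.app o) (θ.map_θbi o)

/-- **`θ^bi` does not exist for the slim sub-model `TFModel.modelSettingSlim p` either** (`swapObj` has
slim `Π = G × G`): so gen 4's `model_slim_cor_3_7 θ` / `model_slim_cor_3_7_v θ` likewise REDUCE (ii),
(iv)-second and (v) to `θ^bi`; only (i), (iii), (iv)-first are discharged there.  The `sB` hypothesis of
print (Cor 1.10) is thus load-bearing for `θ^bi` and not captured by slimness alone.
[cite: MochizukiAbsTopIII2015, Cor 3.7 (ii) p.87] -/
theorem isEmpty_biAnabelianLift_modelSettingSlim :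
    IsEmpty (FiberSquare.BiAnabelianLift (TFModel.modelSettingSlim p).gal) := by
  refine ⟨fun θ => ?_⟩
  let A : TFModel.Slim p := ⟨swapObj p, swapObj_isSlim p⟩
  let o : CategoricalPullback (TFModel.modelSettingSlim p).gal (TFModel.modelSettingSlim p).gal :=
    ⟨A, A, swapGalIso p⟩
  exact gal_map_ne_swap p (θ.θbi.hom.app o).hom (θ.map_θbi o)

end TFModel

end Literature.AnabelianGeometry.AbsoluteAnabelian.AbsTopIII

end
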